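import Literature.AnabelianGeometry.AbsoluteAnabelian.MonoidKummerGaloisCyclotomeIsoHomJunction
import Literature.AnabelianGeometry.AbsoluteAnabelian.MonoidKummerGaloisCyclotomeRestriction
import Literature.AnabelianGeometry.AbsoluteAnabelian.MonoidKummerTransportCanonical
import Literature.AnabelianGeometry.AbsoluteAnabelian.MLFGaloisCategories
import HarnessLib

/-!
# [AbsTopIII] Prop 3.2 (ii) with `μ_Ẑ(G)`-coefficients: the coefficient square is CLOSED UNDER COMPOSITION —
# naturality along every composite of isomorphism legs and restriction legs, unconditionally

S. Mochizuki, *Topics in Absolute Anabelian Geometry III*, §3 (bib key `MochizukiAbsTopIII2015`; kurims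
manuscript pages, lit key `paper:url-5493eb38cbb7`): Def. 3.1 (ii)/(iii) p. 67 (morphisms of MLF-Galois
`TM`-pairs and their category `𝒞^MLF_TM`), Prop. 3.2 (ii) p. 71 l. 58 – p. 72 l. 6 («functorial algorithms …
Kummer maps `M^H_TM → H¹(H, μ_Ẑ(M_TM))` … the «`μ_Ẑ(M_TM)`» may be replaced by «`μ_Ẑ(G)`»), Cor. 1.10 (i) p. 42
(functoriality of `μ_Ẑ(G)` in «arbitrary injective open homomorphisms»).

THE POINT (abc-iut cell, layer L4, node AbsTopIII:Prop3.2(ii), clause (ii.4) = naturality of the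
`μ_Ẑ(G)`-valued Kummer maps).  The tree proves the `Hom`-currency naturality
`GaloisMonoidPair.Hom.pullMuZhat_kummerMuZhat_eq_pushMuZhat_of_square` (abc-iut-w5-d201 p443542) MODULO the
coefficient square
  `hsq(φ) :  Λ(rootsHom₂) ∘ μ_Ẑ(β(φ)) = Λ(φ_M^gp) ∘ Λ(rootsHom₁)`  on `μ_Ẑ(G_{k₁})`,
discharges `hsq` along the ISOMORPHISM legs (`GaloisMonoidPair.Iso.toHom_coeffSquare`, p452879) and along the
field-RESTRICTION legs (`GaloisMonoidPair.Hom.coeffSquare_restrict`, p446357/p447231), and REFUTES it along the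
power endomorphism `(𝟙, x ↦ x²)` (`kummerMuZhat_powEnd_ne`, finding E-L4-10).  This PROOF-ONLY file adds the
one structural fact that turns the two legs into a statement about a SUBCATEGORY of `𝒞^MLF_TM`:

* `comp_galoisHom_apply` / `comp_absGaloisHom(_apply)`: the arithmetic-Galois homomorphism covered by a
  composite `φ ≫ ψ` (`GaloisMonoidPair.Hom.comp`) is the composite `β(ψ) ∘ β(φ)` (uniqueness of the covered
  homomorphism, `eq_galoisHom_of_aug`);
* `comp_muZhatMap_apply`: **`μ_Ẑ(β(φ ≫ ψ)) = μ_Ẑ(β(ψ)) ∘ μ_Ẑ(β(φ))`** — Cor. 1.10 (i)'s functoriality of the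
  group-theoretic cyclotome in composites (abc-iut-L4-d3 `muZhat.mapOfOpenEmbedding_comp`);
* `coeffSquare_comp`: **`hsq(φ) ∧ hsq(ψ) ⟹ hsq(φ ≫ ψ)`** for ANY reciprocity data `R₁, R₂, R₃`
  (`ModelMLFGaloisData.unitsLift_comp`): the morphisms of model `TM`-pairs along which Prop. 3.2 (ii)'s
  `μ_Ẑ(G)`-valued Kummer maps are natural form a subcategory (identities: `coeffSquare_id`);
* `pullMuZhat_kummerMuZhat_eq_pushMuZhat_comp`: the naturality square along `φ ≫ ψ` from `hsq(φ)`, `hsq(ψ)`;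
* `bijective_cyclotome_map_unitsLift_of_coeffSquare`: a NECESSARY condition — along an `hsq`-morphism (any
  reciprocity data) `Λ(φ_M^gp)` is bijective on cyclotomes (`map_rootsHom_bijective`), so e.g. the power
  endomorphism satisfies `hsq` for NO pair of reciprocity data (`ModelMLFGaloisData.not_coeffSquare_powEnd_two`,
  via `not_surjective_cyclotome_map_sq`: `Λ(u ↦ u²)` misses `n ↦ x_n²`, `x` a compatible system of roots of
  `-1`) — the structural form of E-L4-10;
* `coeffSquare_toHom_comp_restrict` / `coeffSquare_restrict_comp_toHom` and the two
  `pullMuZhat_kummerMuZhat_eq_pushMuZhat_…` corollaries: along `ι f ≫ ρ` and `ρ ≫ ι f` (`f` an isomorphism,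
  `ρ` a restriction morphism along `j : Ē ≃ F̄`) the naturality holds with NO residual hypothesis for THE data
  (`TorsionReciprocityData.fundamental`) — i.e. on the subcategory of `𝒞^MLF_TM` generated by print's two
  kinds of legs, through which every injective open homomorphism of absolute Galois groups factors
  (abc-iut-L4-d3 `exists_eq_conj_absGaloisRestrict_comp`).

No definition, no `Prop`-valued definition, no instance; the coefficient square is carried as the explicit
hypothesis shape of p443542, verbatim.  Universe `0`.
HONEST FRAMING: classical Kummer theory / local class field theory as proved in the tree; along a general
morphism of `𝒞^MLF_TM` the square is a genuine condition (E-L4-10); nothing here bears on [IUTchIII] Cor. 3.12;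
no side is taken; nothing asserts that abc is proved or refuted.
-/

noncomputable section

open scoped nonZeroDivisors

namespace Literature.AnabelianGeometry.AbsoluteAnabelian

open Function Field
open Literature.NumberTheory.GaloisRepresentations

namespace GaloisMonoidPair.Hom

variable {C₁ C₂ C₃ : MLFClosure.{0}} {D₁ : ModelMLFGaloisData C₁.k C₁.K} {D₂ : ModelMLFGaloisData C₂.k C₂.K}
  {D₃ : ModelMLFGaloisData C₃.k C₃.K}
  (φ : GaloisMonoidPair.Hom D₁.tmPair D₂.tmPair) (ψ : GaloisMonoidPair.Hom D₂.tmPair D₃.tmPair)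

/-! ### §1 The covered Galois homomorphism of a composite -/

/-- The monoid component of a composite is the composite of the monoid components.
[cite: MochizukiAbsTopIII2015, Definition 3.1 (iii) p.67] -/
theorem comp_homM : (φ.comp ψ).homM = ψ.homM.comp φ.homM := rfl

/-- **`β(φ ≫ ψ) = β(ψ) ∘ β(φ)` on `Gal(k̄/k)`** (uniqueness of the covered homomorphism).
[cite: MochizukiAbsTopIII2015, Definition 3.1 (ii) p.67] -/
theorem comp_galoisHom_apply (σ : C₁.K ≃ₐ[C₁.k] C₁.K) :
    (φ.comp ψ).galoisHom σ = ψ.galoisHom (φ.galoisHom σ) :=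
  ((φ.comp ψ).eq_galoisHom_of_aug (ψ.galoisHom.comp φ.galoisHom) (fun g => by
    rw [MonoidHom.comp_apply, φ.galoisHom_aug, ψ.galoisHom_aug]; rfl) σ).symm

/-- **`β(φ ≫ ψ) = β(ψ) ∘ β(φ)` on Mathlib's absolute Galois groups**, pointwise.
[cite: MochizukiAbsTopIII2015, Definition 3.1 (ii) p.67] -/
theorem comp_absGaloisHom_apply (h₁ : IsOpenMap D₁.aug) (h₂ : IsOpenMap D₂.aug) (σ : absoluteGaloisGroup C₁.k) :
    (φ.comp ψ).absGaloisHom h₁ σ = ψ.absGaloisHom h₂ (φ.absGaloisHom h₁ σ) := by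
  change algEquivContinuousMulEquivAbsoluteGaloisGroup C₃.k C₃.K
      ((φ.comp ψ).galoisHom ((algEquivContinuousMulEquivAbsoluteGaloisGroup C₁.k C₁.K).symm σ)) =
    algEquivContinuousMulEquivAbsoluteGaloisGroup C₃.k C₃.K
      (ψ.galoisHom ((algEquivContinuousMulEquivAbsoluteGaloisGroup C₂.k C₂.K).symm
        (algEquivContinuousMulEquivAbsoluteGaloisGroup C₂.k C₂.K
          (φ.galoisHom ((algEquivContinuousMulEquivAbsoluteGaloisGroup C₁.k C₁.K).symm σ)))))
  rw [ContinuousMulEquiv.symm_apply_apply, comp_galoisHom_apply]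

/-- **`β(φ ≫ ψ) = β(ψ) ∘ β(φ)`** as continuous homomorphisms `G_{k₁} →ₜ* G_{k₃}`.
[cite: MochizukiAbsTopIII2015, Definition 3.1 (ii) p.67] -/
theorem comp_absGaloisHom (h₁ : IsOpenMap D₁.aug) (h₂ : IsOpenMap D₂.aug) :
    (φ.comp ψ).absGaloisHom h₁ = (ψ.absGaloisHom h₂).comp (φ.absGaloisHom h₁) :=
  ContinuousMonoidHom.ext fun σ => comp_absGaloisHom_apply φ ψ h₁ h₂ σ

/-! ### §2 `μ_Ẑ(β)` of a composite -/

/-- **Cor. 1.10 (i) in composites: `μ_Ẑ(β(φ ≫ ψ)) = μ_Ẑ(β(ψ)) ∘ μ_Ẑ(β(φ))`.**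
[cite: MochizukiAbsTopIII2015, Cor 1.10 (i) p.42] -/
theorem comp_muZhatMap_apply (h₁ : IsOpenMap D₁.aug) (h₂ : IsOpenMap D₂.aug) (h₃ : IsOpenMap D₃.aug)
    (ζ : muZhat (absoluteGaloisGroup C₁.k)) :
    (φ.comp ψ).muZhatMap h₁ h₃ ζ = ψ.muZhatMap h₂ h₃ (φ.muZhatMap h₁ h₂ ζ) := by
  have hinj : Injective ((ψ.absGaloisHom h₂).comp (φ.absGaloisHom h₁)) :=
    (ψ.absGaloisHom_injective h₂).comp (φ.absGaloisHom_injective h₁)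
  have hopen : IsOpen (Set.range ((ψ.absGaloisHom h₂).comp (φ.absGaloisHom h₁))) := by
    rw [← comp_absGaloisHom φ ψ h₁ h₂]
    exact (φ.comp ψ).isOpen_range_absGaloisHom h₁ h₃
  rw [muZhatMap, muZhat.mapOfOpenEmbedding_congr_hom (comp_absGaloisHom φ ψ h₁ h₂)
    ((φ.comp ψ).absGaloisHom_injective h₁) ((φ.comp ψ).isOpen_range_absGaloisHom h₁ h₃) hinj hopen]
  exact muZhat.mapOfOpenEmbedding_comp (φ.absGaloisHom h₁) (φ.absGaloisHom_injective h₁)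
    (φ.isOpen_range_absGaloisHom h₁ h₂) (ψ.absGaloisHom h₂) (ψ.absGaloisHom_injective h₂)
    (ψ.isOpen_range_absGaloisHom h₂ h₃) hinj hopen ζ

/-! ### §3 The coefficient square is closed under composition (and holds for identities) -/

/-- `Λ` is functorial: `Λ(g ∘ f) = Λ(g) ∘ Λ(f)` on cyclotomes. [cite: MochizukiAbsTopIII2015, Remark 3.2.1 p.73] -/
theorem cyclotome_map_comp_apply {A B E : Type} [CommGroup A] [CommGroup B] [CommGroup E]
    (f : A →* B) (g : B →* E) (ζ : EtaleTheta.cyclotome A) :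
    EtaleTheta.cyclotome.map (g.comp f) ζ = EtaleTheta.cyclotome.map g (EtaleTheta.cyclotome.map f ζ) :=
  Subtype.ext (funext fun n => by simp only [EtaleTheta.cyclotome.map_apply, MonoidHom.comp_apply])

section Composition

variable (h₁ : IsOpenMap D₁.aug) (h₂ : IsOpenMap D₂.aug) (h₃ : IsOpenMap D₃.aug)
  (R₁ : TorsionReciprocityData C₁.k) (R₂ : TorsionReciprocityData C₂.k) (R₃ : TorsionReciprocityData C₃.k)

/-- **THE COEFFICIENT SQUARE IS CLOSED UNDER COMPOSITION**: if `Λ(rootsHom₂) ∘ μ_Ẑ(β(φ)) = Λ(φ_M^gp) ∘ Λ(rootsHom₁)`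
and `Λ(rootsHom₃) ∘ μ_Ẑ(β(ψ)) = Λ(ψ_M^gp) ∘ Λ(rootsHom₂)`, then
`Λ(rootsHom₃) ∘ μ_Ẑ(β(φ ≫ ψ)) = Λ((φ ≫ ψ)_M^gp) ∘ Λ(rootsHom₁)` — for ANY reciprocity data `R₁, R₂, R₃`.
[cite: MochizukiAbsTopIII2015, Proposition 3.2 (ii) p.72] -/
theorem coeffSquare_comp
    (hφ : ∀ ζ : muZhat (absoluteGaloisGroup C₁.k),
      EtaleTheta.cyclotome.map (ModelMLFGaloisData.rootsHom C₂ R₂) (φ.muZhatMap h₁ h₂ ζ) =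
        EtaleTheta.cyclotome.map (ModelMLFGaloisData.unitsLift φ.homM)
          (EtaleTheta.cyclotome.map (ModelMLFGaloisData.rootsHom C₁ R₁) ζ))
    (hψ : ∀ ζ : muZhat (absoluteGaloisGroup C₂.k),
      EtaleTheta.cyclotome.map (ModelMLFGaloisData.rootsHom C₃ R₃) (ψ.muZhatMap h₂ h₃ ζ) =
        EtaleTheta.cyclotome.map (ModelMLFGaloisData.unitsLift ψ.homM)
          (EtaleTheta.cyclotome.map (ModelMLFGaloisData.rootsHom C₂ R₂) ζ))
    (ζ : muZhat (absoluteGaloisGroup C₁.k)) :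
    EtaleTheta.cyclotome.map (ModelMLFGaloisData.rootsHom C₃ R₃) ((φ.comp ψ).muZhatMap h₁ h₃ ζ) =
      EtaleTheta.cyclotome.map (ModelMLFGaloisData.unitsLift (φ.comp ψ).homM)
        (EtaleTheta.cyclotome.map (ModelMLFGaloisData.rootsHom C₁ R₁) ζ) := by
  rw [comp_muZhatMap_apply φ ψ h₁ h₂ h₃, hψ, hφ, comp_homM, ModelMLFGaloisData.unitsLift_comp,
    cyclotome_map_comp_apply]

/-- **[AbsTopIII] Prop 3.2 (ii) along a COMPOSITE, given the two coefficient squares.**  For morphisms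
`φ : (Π₁ ↷ 𝒪_k̄₁^⊳) → (Π₂ ↷ 𝒪_k̄₂^⊳)`, `ψ : (Π₂ ↷ 𝒪_k̄₂^⊳) → (Π₃ ↷ 𝒪_k̄₃^⊳)` of model `TM`-pairs (open
augmentations) satisfying `hsq`, open `H₁ ⊆ Π₁`, `H₃ ⊆ Π₃` with `(φ ≫ ψ)_Π(H₁) ⊆ H₃` and `m ∈ (𝒪_k̄₁^⊳)^{H₁}` with
`ψ_M(φ_M m) ∈ (𝒪_k̄₃^⊳)^{H₃}`: `(φ ≫ ψ)_Π^* κ^G_{H₃}(ψ_M φ_M m) = μ_Ẑ(β(φ ≫ ψ))_* κ^G_{H₁}(m)`.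
[cite: MochizukiAbsTopIII2015, Proposition 3.2 (ii) p.72] -/
theorem pullMuZhat_kummerMuZhat_eq_pushMuZhat_comp
    (hφ : ∀ ζ : muZhat (absoluteGaloisGroup C₁.k),
      EtaleTheta.cyclotome.map (ModelMLFGaloisData.rootsHom C₂ R₂) (φ.muZhatMap h₁ h₂ ζ) =
        EtaleTheta.cyclotome.map (ModelMLFGaloisData.unitsLift φ.homM)
          (EtaleTheta.cyclotome.map (ModelMLFGaloisData.rootsHom C₁ R₁) ζ))
    (hψ : ∀ ζ : muZhat (absoluteGaloisGroup C₂.k),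
      EtaleTheta.cyclotome.map (ModelMLFGaloisData.rootsHom C₃ R₃) (ψ.muZhatMap h₂ h₃ ζ) =
        EtaleTheta.cyclotome.map (ModelMLFGaloisData.unitsLift ψ.homM)
          (EtaleTheta.cyclotome.map (ModelMLFGaloisData.rootsHom C₂ R₂) ζ))
    {H₁ : OpenSubgroup D₁.tmPair.Pi} {H₃ : OpenSubgroup D₃.tmPair.Pi}
    (hH : (H₁ : Subgroup D₁.Pi).map (φ.comp ψ).homPi ≤ (H₃ : Subgroup D₃.Pi))
    (m : {m : D₁.tmPair.M // ∀ h : H₁, (h : D₁.tmPair.Pi) • m = m})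
    (hm : ∀ h : H₃, (h : D₃.tmPair.Pi) • (φ.comp ψ).homM m.1 = (φ.comp ψ).homM m.1) :
    (φ.comp ψ).pullMuZhat R₃ hH (ModelMLFGaloisData.kummerMuZhat C₃ D₃ R₃ H₃ ⟨(φ.comp ψ).homM m.1, hm⟩) =
      (φ.comp ψ).pushMuZhat h₁ h₃ R₁ R₃ hH (ModelMLFGaloisData.kummerMuZhat C₁ D₁ R₁ H₁ m) :=
  (φ.comp ψ).pullMuZhat_kummerMuZhat_eq_pushMuZhat_of_square h₁ h₃ R₁ R₃ hH
    (coeffSquare_comp φ ψ h₁ h₂ h₃ R₁ R₂ R₃ hφ hψ) m hm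

end Composition

/-- `β(𝟙) = 𝟙` on `Gal(k̄/k)`. [cite: MochizukiAbsTopIII2015, Definition 3.1 (iii) p.67] -/
theorem id_galoisHom_apply (σ : C₁.K ≃ₐ[C₁.k] C₁.K) :
    (Hom.id D₁.tmPair).galoisHom σ = σ :=
  ((Hom.id D₁.tmPair).eq_galoisHom_of_aug (MonoidHom.id _) (fun _ => rfl) σ).symm

/-- `β(𝟙) = 𝟙` on the absolute Galois group. [cite: MochizukiAbsTopIII2015, Definition 3.1 (iii) p.67] -/
theorem id_absGaloisHom_apply (h₁ : IsOpenMap D₁.aug) (σ : absoluteGaloisGroup C₁.k) :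
    (Hom.id D₁.tmPair).absGaloisHom h₁ σ = σ := by
  change algEquivContinuousMulEquivAbsoluteGaloisGroup C₁.k C₁.K
      ((Hom.id D₁.tmPair).galoisHom ((algEquivContinuousMulEquivAbsoluteGaloisGroup C₁.k C₁.K).symm σ)) = σ
  rw [id_galoisHom_apply, ContinuousMulEquiv.apply_symm_apply]

/-- `μ_Ẑ(β(𝟙)) = 𝟙`. [cite: MochizukiAbsTopIII2015, Cor 1.10 (i) p.42] -/
theorem id_muZhatMap_apply (h₁ : IsOpenMap D₁.aug) (ζ : muZhat (absoluteGaloisGroup C₁.k)) :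
    (Hom.id D₁.tmPair).muZhatMap h₁ h₁ ζ = ζ := by
  have hid : (Hom.id D₁.tmPair).absGaloisHom h₁ =
      ((ContinuousMulEquiv.refl (absoluteGaloisGroup C₁.k) :
        absoluteGaloisGroup C₁.k ≃ₜ* absoluteGaloisGroup C₁.k) :
          absoluteGaloisGroup C₁.k →ₜ* absoluteGaloisGroup C₁.k) :=
    ContinuousMonoidHom.ext fun σ => id_absGaloisHom_apply h₁ σ
  have hinj : Injective ((ContinuousMulEquiv.refl (absoluteGaloisGroup C₁.k) :
        absoluteGaloisGroup C₁.k ≃ₜ* absoluteGaloisGroup C₁.k) :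
          absoluteGaloisGroup C₁.k →ₜ* absoluteGaloisGroup C₁.k) := fun _ _ h => h
  have hopen : IsOpen (Set.range ((ContinuousMulEquiv.refl (absoluteGaloisGroup C₁.k) :
        absoluteGaloisGroup C₁.k ≃ₜ* absoluteGaloisGroup C₁.k) :
          absoluteGaloisGroup C₁.k →ₜ* absoluteGaloisGroup C₁.k)) := by
    rw [← hid]
    exact (Hom.id D₁.tmPair).isOpen_range_absGaloisHom h₁ h₁
  rw [muZhatMap, muZhat.mapOfOpenEmbedding_congr_hom hid ((Hom.id D₁.tmPair).absGaloisHom_injective h₁)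
    ((Hom.id D₁.tmPair).isOpen_range_absGaloisHom h₁ h₁) hinj hopen,
    muZhat.mapOfOpenEmbedding_coe_continuousMulEquiv _ hinj hopen]
  exact Subtype.ext (funext fun n => by rw [muZhat.map_apply_coe, muQZ.map_refl, ofAdd_toAdd])

/-- **The coefficient square holds for the identity** (any reciprocity data): the identities lie in the
`hsq`-subcategory. [cite: MochizukiAbsTopIII2015, Proposition 3.2 (ii) p.72] -/
theorem coeffSquare_id (h₁ : IsOpenMap D₁.aug) (R₁ : TorsionReciprocityData C₁.k)
    (ζ : muZhat (absoluteGaloisGroup C₁.k)) :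
    EtaleTheta.cyclotome.map (ModelMLFGaloisData.rootsHom C₁ R₁) ((Hom.id D₁.tmPair).muZhatMap h₁ h₁ ζ) =
      EtaleTheta.cyclotome.map (ModelMLFGaloisData.unitsLift (Hom.id D₁.tmPair).homM)
        (EtaleTheta.cyclotome.map (ModelMLFGaloisData.rootsHom C₁ R₁) ζ) := by
  rw [id_muZhatMap_apply, show (Hom.id D₁.tmPair).homM = MonoidHom.id _ from rfl,
    ModelMLFGaloisData.unitsLift_id]
  exact (Subtype.ext (funext fun n => by simp only [EtaleTheta.cyclotome.map_apply, MonoidHom.id_apply]))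

/-! ### §4 A necessary condition: along an `hsq`-morphism, `Λ(φ_M^gp)` is BIJECTIVE on cyclotomes -/

/-- **If the coefficient square holds for `φ` (any reciprocity data), then `Λ(φ_M^gp) : Λ(k̄₁ˣ) → Λ(k̄₂ˣ)` is
bijective** — because `Λ(rootsHom₁)`, `Λ(rootsHom₂)` (Rmk. 3.2.1, `map_rootsHom_bijective`) and the
group-theoretic `μ_Ẑ(β)` (Cor. 1.10 (i)) are.  Contrapositively: a morphism of `𝒞^MLF_TM` whose monoid component
is not bijective on cyclotomes (e.g. the power endomorphism `(𝟙, x ↦ x²)`, finding E-L4-10) satisfies the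
coefficient square for NO choice of reciprocity data. [cite: MochizukiAbsTopIII2015, Remark 3.2.1 p.73] -/
theorem bijective_cyclotome_map_unitsLift_of_coeffSquare (h₁ : IsOpenMap D₁.aug) (h₂ : IsOpenMap D₂.aug)
    (R₁ : TorsionReciprocityData C₁.k) (R₂ : TorsionReciprocityData C₂.k)
    (hφ : ∀ ζ : muZhat (absoluteGaloisGroup C₁.k),
      EtaleTheta.cyclotome.map (ModelMLFGaloisData.rootsHom C₂ R₂) (φ.muZhatMap h₁ h₂ ζ) =
        EtaleTheta.cyclotome.map (ModelMLFGaloisData.unitsLift φ.homM)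
          (EtaleTheta.cyclotome.map (ModelMLFGaloisData.rootsHom C₁ R₁) ζ)) :
    Bijective (EtaleTheta.cyclotome.map (ModelMLFGaloisData.unitsLift φ.homM)) := by
  have hcomp : (EtaleTheta.cyclotome.map (ModelMLFGaloisData.unitsLift φ.homM)) ∘
        (EtaleTheta.cyclotome.map (ModelMLFGaloisData.rootsHom C₁ R₁)) =
      (EtaleTheta.cyclotome.map (ModelMLFGaloisData.rootsHom C₂ R₂)) ∘ (φ.muZhatMap h₁ h₂) :=
    funext fun ζ => (hφ ζ).symm
  have hbij : Bijective ((EtaleTheta.cyclotome.map (ModelMLFGaloisData.unitsLift φ.homM)) ∘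
      (EtaleTheta.cyclotome.map (ModelMLFGaloisData.rootsHom C₁ R₁))) := by
    rw [hcomp]
    exact (ModelMLFGaloisData.map_rootsHom_bijective C₂ R₂).comp (φ.muZhatMap h₁ h₂).bijective
  exact (Bijective.of_comp_iff _ (ModelMLFGaloisData.map_rootsHom_bijective C₁ R₁)).mp hbij

end GaloisMonoidPair.Hom

/-! ### §4b The power endomorphism `(𝟙, x ↦ x²)` satisfies the coefficient square for NO reciprocity data -/

namespace ModelMLFGaloisData

variable (C : MLFClosure.{0}) (D : ModelMLFGaloisData C.k C.K)

/-- `(x ↦ x²)^gp = (u ↦ u²)` on `k̄ˣ`. [cite: MochizukiAbsTopIII2015, Definition 3.1 (iii) p.68] -/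
theorem unitsLift_powEnd_two :
    unitsLift (GaloisMonoidPair.Hom.homM (GaloisMonoidPair.powEnd D.tmPair 2)) = powMonoidHom 2 :=
  (unitsLift_unique _ (powMonoidHom 2) fun m => by
    rw [powMonoidHom_apply, GaloisMonoidPair.powEnd_homM_apply, ← toUnitHom_apply, ← toUnitHom_apply,
      map_pow]).symm

/-- **`Λ(u ↦ u²)` is NOT surjective on `Λ(k̄ˣ) = Ẑ(1)`** (`2 ∉ Ẑˣ`): the compatible system `n ↦ x_n²` built
from a compatible system of roots `x` of `-1` has `2`-component `x_2² = -1`, whereas the `2`-component of any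
square of an element of `Λ(k̄ˣ)` is `1`; `-1 ≠ 1` in characteristic `0`.
[cite: MochizukiAbsTopIII2015, Remark 3.2.1 p.73] -/
theorem not_surjective_cyclotome_map_sq :
    ¬ Surjective (EtaleTheta.cyclotome.map (powMonoidHom 2 : (C.K)ˣ →* (C.K)ˣ)) := by
  haveI : CharZero C.K := charZero_of_injective_algebraMap (algebraMap C.k C.K).injective
  intro hs
  -- a compatible system of roots of `-1 ∈ k̄ˣ` (`k̄` algebraically closed)
  let x : EtaleTheta.RootSystem (-1 : (C.K)ˣ) := EtaleTheta.RootSystem.ofRootableBy _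
  -- `n ↦ x_n²` lies in the cyclotome
  let ζ : EtaleTheta.cyclotome (C.K)ˣ := ⟨fun n => x.root n ^ 2,
    ⟨fun n => by
      show (x.root n ^ 2) ^ (n : ℕ) = 1
      rw [← pow_mul, mul_comm 2 (n : ℕ), pow_mul, x.pow_self, neg_one_sq],
     fun n m => by
      show (x.root (n * m) ^ 2) ^ (m : ℕ) = x.root n ^ 2
      rw [← pow_mul, mul_comm 2 (m : ℕ), pow_mul, x.root_mul_pow]⟩⟩
  obtain ⟨ξ, hξ⟩ := hs ζ
  have h2 : ((ξ : ℕ+ → (C.K)ˣ) 2) ^ 2 = x.root 2 ^ 2 := by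
    have := congrArg (fun η : EtaleTheta.cyclotome (C.K)ˣ => (η : ℕ+ → (C.K)ˣ) 2) hξ
    simpa only [EtaleTheta.cyclotome.map_apply, powMonoidHom_apply] using this
  have hone : ((ξ : ℕ+ → (C.K)ˣ) 2) ^ 2 = 1 := EtaleTheta.cyclotome.pow_eq_one ξ 2
  have hneg : x.root 2 ^ 2 = -1 := x.pow_self 2
  rw [hone, hneg] at h2
  have h2' : ((1 : (C.K)ˣ) : C.K) = ((-1 : (C.K)ˣ) : C.K) := congrArg Units.val h2
  rw [Units.val_one, Units.val_neg, Units.val_one] at h2'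
  exact one_ne_zero (by linear_combination h2' / 2 : (1 : C.K) = 0)

/-- **The power endomorphism `(𝟙_Π, x ↦ x²)` of a model `TM`-pair satisfies the coefficient square `hsq` for
NO pair of reciprocity data** (open augmentation) — the structural form of finding E-L4-10: `Λ(x ↦ x²)` is not
bijective on `Ẑ(1)`, while along any `hsq`-morphism `Λ(φ_M^gp)` must be
(`bijective_cyclotome_map_unitsLift_of_coeffSquare`). [cite: MochizukiAbsTopIII2015, Proposition 3.2 (ii) p.72] -/
theorem not_coeffSquare_powEnd_two (h : IsOpenMap D.aug) (R₁ R₂ : TorsionReciprocityData C.k) :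
    ¬ ∀ ζ : muZhat (absoluteGaloisGroup C.k),
      EtaleTheta.cyclotome.map (rootsHom C R₂)
          (GaloisMonoidPair.Hom.muZhatMap (GaloisMonoidPair.powEnd D.tmPair 2) h h ζ) =
        EtaleTheta.cyclotome.map (unitsLift (GaloisMonoidPair.Hom.homM (GaloisMonoidPair.powEnd D.tmPair 2)))
          (EtaleTheta.cyclotome.map (rootsHom C R₁) ζ) := by
  intro hsq
  have hb := GaloisMonoidPair.Hom.bijective_cyclotome_map_unitsLift_of_coeffSquare
    (GaloisMonoidPair.powEnd D.tmPair 2) h h R₁ R₂ hsq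
  rw [unitsLift_powEnd_two] at hb
  exact not_surjective_cyclotome_map_sq C hb.2

end ModelMLFGaloisData

namespace GaloisMonoidPair.Hom

variable {C₁ C₂ C₃ : MLFClosure.{0}} {D₁ : ModelMLFGaloisData C₁.k C₁.K} {D₂ : ModelMLFGaloisData C₂.k C₂.K}
  {D₃ : ModelMLFGaloisData C₃.k C₃.K}

/-! ### §5 The subcategory generated by print's legs: `ι f ≫ ρ` and `ρ ≫ ι f`, unconditionally for THE data -/

section Legs

variable [Algebra C₃.k C₂.k] [FiniteDimensional C₃.k C₂.k] [Algebra C₃.k C₂.K] [IsScalarTower C₃.k C₂.k C₂.K]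
  [ValuativeExtension C₃.k C₂.k]
  (j : C₂.K ≃ₐ[C₃.k] C₃.K)
  (f : GaloisMonoidPair.Iso D₁.tmPair D₂.tmPair) (ρ : GaloisMonoidPair.Hom D₂.tmPair D₃.tmPair)
  (haug : ∀ (g : D₂.Pi) (x : C₂.K), D₃.aug (ρ.homPi g) (j x) = j (D₂.aug g x))
  (hρM : ∀ m : nonzeroIntegers C₂.k C₂.K, ((ρ.homM m : nonzeroIntegers C₃.k C₃.K) : C₃.K) = j (m : C₂.K))
  (h₁ : IsOpenMap D₁.aug) (h₂ : IsOpenMap D₂.aug) (h₃ : IsOpenMap D₃.aug)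

include haug hρM h₂ in
/-- **The coefficient square for `ι f ≫ ρ`** (isomorphism, then restriction along `j : Ē ≃ F̄`), THE data.
[cite: MochizukiAbsTopIII2015, Proposition 3.2 (ii) p.72] -/
theorem coeffSquare_toHom_comp_restrict (ζ : muZhat (absoluteGaloisGroup C₁.k)) :
    EtaleTheta.cyclotome.map (ModelMLFGaloisData.rootsHom C₃ (TorsionReciprocityData.fundamental C₃.k))
        ((f.toHom.comp ρ).muZhatMap h₁ h₃ ζ) =
      EtaleTheta.cyclotome.map (ModelMLFGaloisData.unitsLift (f.toHom.comp ρ).homM)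
        (EtaleTheta.cyclotome.map
          (ModelMLFGaloisData.rootsHom C₁ (TorsionReciprocityData.fundamental C₁.k)) ζ) :=
  coeffSquare_comp f.toHom ρ h₁ h₂ h₃ _ _ _ (f.toHom_coeffSquare h₁ h₂) (ρ.coeffSquare_restrict j haug hρM h₂ h₃) ζ

include haug hρM h₂ in
/-- **[AbsTopIII] Prop 3.2 (ii) along `ι f ≫ ρ`, UNCONDITIONALLY for THE data**: open `H₁ ⊆ Π₁`, `H₃ ⊆ Π₃` with
`ρ_Π(f_Π(H₁)) ⊆ H₃`, `m ∈ (𝒪_k̄₁^⊳)^{H₁}` with `ρ_M(f_M m) ∈ (𝒪_k̄₃^⊳)^{H₃}`.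
[cite: MochizukiAbsTopIII2015, Proposition 3.2 (ii) p.72] -/
theorem pullMuZhat_kummerMuZhat_eq_pushMuZhat_toHom_comp_restrict
    {H₁ : OpenSubgroup D₁.tmPair.Pi} {H₃ : OpenSubgroup D₃.tmPair.Pi}
    (hH : (H₁ : Subgroup D₁.Pi).map (f.toHom.comp ρ).homPi ≤ (H₃ : Subgroup D₃.Pi))
    (m : {m : D₁.tmPair.M // ∀ h : H₁, (h : D₁.tmPair.Pi) • m = m})
    (hm : ∀ h : H₃, (h : D₃.tmPair.Pi) • (f.toHom.comp ρ).homM m.1 = (f.toHom.comp ρ).homM m.1) :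
    (f.toHom.comp ρ).pullMuZhat (TorsionReciprocityData.fundamental C₃.k) hH
        (ModelMLFGaloisData.kummerMuZhat C₃ D₃ (TorsionReciprocityData.fundamental C₃.k) H₃
          ⟨(f.toHom.comp ρ).homM m.1, hm⟩) =
      (f.toHom.comp ρ).pushMuZhat h₁ h₃ (TorsionReciprocityData.fundamental C₁.k)
        (TorsionReciprocityData.fundamental C₃.k) hH
        (ModelMLFGaloisData.kummerMuZhat C₁ D₁ (TorsionReciprocityData.fundamental C₁.k) H₁ m) :=
  (f.toHom.comp ρ).pullMuZhat_kummerMuZhat_eq_pushMuZhat_of_square h₁ h₃ _ _ hH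
    (coeffSquare_toHom_comp_restrict j f ρ haug hρM h₁ h₂ h₃) m hm

end Legs

section Legs'

variable [Algebra C₂.k C₁.k] [FiniteDimensional C₂.k C₁.k] [Algebra C₂.k C₁.K] [IsScalarTower C₂.k C₁.k C₁.K]
  [ValuativeExtension C₂.k C₁.k]
  (j : C₁.K ≃ₐ[C₂.k] C₂.K)
  (ρ : GaloisMonoidPair.Hom D₁.tmPair D₂.tmPair) (f : GaloisMonoidPair.Iso D₂.tmPair D₃.tmPair)
  (haug : ∀ (g : D₁.Pi) (x : C₁.K), D₂.aug (ρ.homPi g) (j x) = j (D₁.aug g x))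
  (hρM : ∀ m : nonzeroIntegers C₁.k C₁.K, ((ρ.homM m : nonzeroIntegers C₂.k C₂.K) : C₂.K) = j (m : C₁.K))
  (h₁ : IsOpenMap D₁.aug) (h₂ : IsOpenMap D₂.aug) (h₃ : IsOpenMap D₃.aug)

include haug hρM h₂ in
/-- **The coefficient square for `ρ ≫ ι f`** (restriction along `j : Ē ≃ F̄`, then an isomorphism), THE data.
[cite: MochizukiAbsTopIII2015, Proposition 3.2 (ii) p.72] -/
theorem coeffSquare_restrict_comp_toHom (ζ : muZhat (absoluteGaloisGroup C₁.k)) :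
    EtaleTheta.cyclotome.map (ModelMLFGaloisData.rootsHom C₃ (TorsionReciprocityData.fundamental C₃.k))
        ((ρ.comp f.toHom).muZhatMap h₁ h₃ ζ) =
      EtaleTheta.cyclotome.map (ModelMLFGaloisData.unitsLift (ρ.comp f.toHom).homM)
        (EtaleTheta.cyclotome.map
          (ModelMLFGaloisData.rootsHom C₁ (TorsionReciprocityData.fundamental C₁.k)) ζ) :=
  coeffSquare_comp ρ f.toHom h₁ h₂ h₃ _ _ _ (ρ.coeffSquare_restrict j haug hρM h₁ h₂) (f.toHom_coeffSquare h₂ h₃) ζ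

include haug hρM h₂ in
/-- **[AbsTopIII] Prop 3.2 (ii) along `ρ ≫ ι f`, UNCONDITIONALLY for THE data.**
[cite: MochizukiAbsTopIII2015, Proposition 3.2 (ii) p.72] -/
theorem pullMuZhat_kummerMuZhat_eq_pushMuZhat_restrict_comp_toHom
    {H₁ : OpenSubgroup D₁.tmPair.Pi} {H₃ : OpenSubgroup D₃.tmPair.Pi}
    (hH : (H₁ : Subgroup D₁.Pi).map (ρ.comp f.toHom).homPi ≤ (H₃ : Subgroup D₃.Pi))
    (m : {m : D₁.tmPair.M // ∀ h : H₁, (h : D₁.tmPair.Pi) • m = m})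
    (hm : ∀ h : H₃, (h : D₃.tmPair.Pi) • (ρ.comp f.toHom).homM m.1 = (ρ.comp f.toHom).homM m.1) :
    (ρ.comp f.toHom).pullMuZhat (TorsionReciprocityData.fundamental C₃.k) hH
        (ModelMLFGaloisData.kummerMuZhat C₃ D₃ (TorsionReciprocityData.fundamental C₃.k) H₃
          ⟨(ρ.comp f.toHom).homM m.1, hm⟩) =
      (ρ.comp f.toHom).pushMuZhat h₁ h₃ (TorsionReciprocityData.fundamental C₁.k)
        (TorsionReciprocityData.fundamental C₃.k) hH
        (ModelMLFGaloisData.kummerMuZhat C₁ D₁ (TorsionReciprocityData.fundamental C₁.k) H₁ m) :=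
  (ρ.comp f.toHom).pullMuZhat_kummerMuZhat_eq_pushMuZhat_of_square h₁ h₃ _ _ hH
    (coeffSquare_restrict_comp_toHom j ρ f haug hρM h₁ h₂ h₃) m hm

end Legs'

end GaloisMonoidPair.Hom

end Literature.AnabelianGeometry.AbsoluteAnabelian

end
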